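import Summits.ValiantsHypothesis.ValiantsHypothesis.Theses.TwistedDetRank
import Summits.ValiantsHypothesis.ValiantsHypothesis.Theorems.TwistedDetRankDirectSumToTdr
import Summits.ValiantsHypothesis.ValiantsHypothesis.Theorems.TwistedDetRankTdrSuperadditive

/-!
# Crux `TwistedDetRank.FermionicNormalForm` (stmt-ValiantsHypothesis-6283), line `registered`
# (= `Cruxes/FermionicNormalForm/Lines/birth.lean`) — definitions, and where the bet sits

The line splits the crux X2 of route `TwistedDetRank` ("every p-computable class-function
generalised matrix function `f_n = Σ_σ χ_n(σ) Π_i X_{σ(i),i}` is, for `n ≥ 1`, a sum of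
quasi-polynomially many Hadamard-twisted determinants `det(X ∘ E_t)`") as
CLASSIFICATION (A) ∘ CONSTRUCTION (B) through an explicit combinatorial normal form for class
functions on `S_n`, QUASI-LOCALITY.  §1 holds the four `Prop`-valued definitions of the line,
verbatim from the registered skeleton (the stub theorem files
`TwistedDetRankFermionicNormalFormStub*.lean` are definition-free):

* `IsLocalGenerator n w g` — `g : S_n → ℂ` is a LOCAL GENERATOR of weight `≤ w`: either the
  fermionic end `σ ↦ sgn σ · F(c₁ σ) · Π_{j ∈ m} c_j(σ)` (`F : ℕ → ℂ` arbitrary in the number of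
  fixed points `c₁`, `m` a multiset of cycle lengths `≥ 2` with `m.sum ≤ w`,
  `c_j(σ) = σ.cycleType.count j`; these are `sgn ·` the monomials of the character polynomials,
  e.g. the coefficient functions of `det`, of `det(X ∘ (J + (u-1)I))` and of the easy immanants),
  or the perturbative end (a function of the cycle type supported on permutations moving `≤ w`
  points);
* `IsQuasiLocal χ` — for some `c` and every `n ≥ 1`, `χ_n` is a linear combination of
  `≤ 2^((log₂ n + c)^c)` local generators of weight `≤ (log₂ n + c)^c`;
* `CheapClassFunctionsAreQuasiLocal` (A, the bet; OPEN) — a p-computable class-function GMF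
  family has quasi-local coefficients;
* `LocalGeneratorsSmallTdr` (B, provable; proved piecewise by the stub files) — a local generator
  of weight `w` on `S_n`, `n ≥ 1`, is a sum of `(n+1)^(w+1)` twisted determinants.

§2 is the lead's CALIBRATION of the bet (kernel-checked, elementary): **A alone implies the summit**
(`valiantsHypothesis_of_cheapClassFunctionsAreQuasiLocal`).  Under `VP ℂ = VNP ℂ` the permanent
family is p-computable (tree: `isPComputable_perPoly_complex_iff`), `per_n` is the class-function
GMF with `χ ≡ 1`, and `χ ≡ 1` is NOT quasi-local (`one_not_isQuasiLocal`): for `n = 2^k` with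
`8·W < n`, `W = (k + c)^c`, an `n`-cycle `σ` and a permutation `τ` of cycle type `(W+2, n-W-2)`
have no fixed points, no cycle of length `≤ W`, and move `n > W` points, so EVERY local generator
`g` of weight `W` satisfies `g σ · sgn σ = g τ · sgn τ` (`IsLocalGenerator.mul_sign_eq`), whence
every combination `χ` of such generators has `χ σ · sgn σ = χ τ · sgn τ`; for `χ ≡ 1` this says
`sgn σ = sgn τ`, but the two signs differ.  So stub A is at least summit-hard: the line cannot
close X2 short of proving `VP ℂ ≠ VNP ℂ`, exactly as `ImmanantSlice.DeterminantalRigidity`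
(`Theorems/ImmanantSliceDeterminantalRigidityReductions.lean`) is at least `VBP ≠ VNP`-hard.

Sources: M. Marcus, H. Minc, Illinois J. Math. 5 (1961); P. Bürgisser, *Completeness and
Reduction in Algebraic Complexity Theory* (2000), Ch. 2 (Rem. 2.11, Thm. 2.10) and Ch. 7;
R. Curticapean, STOC 2021 (arXiv:2102.04340); S. Mertens, C. Moore, Theory Comput. 9 (2013).
No named facts are assumed; nothing in §1 is claimed proved.
-/

-- single-conjunct layout: Sub = Summit, duplicated namespace component intended
set_option linter.dupNamespace false

noncomputable section

namespace Summit.ValiantsHypothesis.ValiantsHypothesis.Theorems.TwistedDetRankFermionicNormalForm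

open Literature.Computability.AlgebraicComplexity
open scoped BigOperators

/-! ## §1 The normal form (definitions, verbatim from the registered skeleton) -/

/-- A LOCAL GENERATOR of weight `≤ w` on `S_n`: either the fermionic end
`σ ↦ sgn σ · F(c₁ σ) · Π_{j ∈ m} c_j(σ)` (`F` arbitrary in the number of fixed points, `m` a multiset
of cycle lengths `≥ 2` of total weight `m.sum ≤ w`, `c_j(σ) = σ.cycleType.count j`), or the
perturbative end: a function of the cycle type supported on permutations moving `≤ w` points.
[this line; MarcusMinc1961, Curticapean2021] -/
def IsLocalGenerator (n w : ℕ) (g : Equiv.Perm (Fin n) → ℂ) : Prop :=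
  (∃ (F : ℕ → ℂ) (m : Multiset ℕ), (∀ j ∈ m, 2 ≤ j) ∧ m.sum ≤ w ∧
      g = fun σ => ((Equiv.Perm.sign σ : ℤ) : ℂ) *
        F (Finset.univ.filter fun i => σ i = i).card *
        (m.map fun j => ((σ.cycleType.count j : ℕ) : ℂ)).prod) ∨
  (∃ G : Multiset ℕ → ℂ, g = fun σ => if σ.support.card ≤ w then G σ.cycleType else 0)

/-- QUASI-LOCALITY of a family of coefficient functions `χ_n : S_n → ℂ`: for some `c` and every
`n ≥ 1`, `χ_n` is a linear combination of at most `2^((log₂ n + c)^c)` local generators of weight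
`≤ (log₂ n + c)^c`. [this line] -/
def IsQuasiLocal (χ : (n : ℕ) → Equiv.Perm (Fin n) → ℂ) : Prop :=
  ∃ c : ℕ, ∀ n : ℕ, 1 ≤ n → ∃ r ≤ 2 ^ ((Nat.log 2 n + c) ^ c),
    ∃ (a : Fin r → ℂ) (g : Fin r → Equiv.Perm (Fin n) → ℂ),
      (∀ t, IsLocalGenerator n ((Nat.log 2 n + c) ^ c) (g t)) ∧ χ n = ∑ t, a t • g t

/-- **A — CHEAP CLASS FUNCTIONS ARE QUASI-LOCAL** (the line's bet; OPEN, conjecture-grade — by §2 it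
implies Valiant's hypothesis): if `χ_n` are class functions on `S_n` and the GMF family
`f_n = Σ_σ χ_n(σ) Π_i X_{σ(i),i}` is p-computable over `ℂ`, then `χ` is quasi-local.
[conjecture-grade: Curticapean2021, Burgisser2000 Ch. 7, MertensMoore2013] -/
def CheapClassFunctionsAreQuasiLocal : Prop :=
  ∀ χ : (n : ℕ) → Equiv.Perm (Fin n) → ℂ,
    (∀ (n : ℕ) (σ τ : Equiv.Perm (Fin n)), χ n (τ * σ * τ⁻¹) = χ n σ) →
    IsPComputable (fun n => ∑ σ : Equiv.Perm (Fin n), MvPolynomial.C (χ n σ) *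
      ∏ i : Fin n, (MvPolynomial.X (σ i, i) : MvPolynomial (Fin n × Fin n) ℂ)) →
    IsQuasiLocal χ

/-- **B — LOCAL GENERATORS HAVE FEW TWISTED DETERMINANTS** (provable; being proved piecewise by the
line's stub files): a local generator of weight `w` on `S_n`, `n ≥ 1`, is a sum of `(n+1)^(w+1)`
Hadamard-twisted determinants `det(X ∘ E_t)` (zero twists allowed as padding).
[MarcusMinc1961, Burgisser2000 §7.1] -/
def LocalGeneratorsSmallTdr : Prop :=
  ∀ (n w : ℕ) (g : Equiv.Perm (Fin n) → ℂ), 1 ≤ n → IsLocalGenerator n w g →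
    ∃ E : Fin ((n + 1) ^ (w + 1)) → Matrix (Fin n) (Fin n) ℂ,
      (∑ σ : Equiv.Perm (Fin n), MvPolynomial.C (g σ) *
          ∏ i : Fin n, (MvPolynomial.X (σ i, i) : MvPolynomial (Fin n × Fin n) ℂ)) =
        ∑ t, (Matrix.of fun i j => MvPolynomial.C (E t i j) * MvPolynomial.X (i, j)).det

/-! ## §2 Calibration: the bet A alone implies the summit -/

/-- A local generator of weight `W` cannot separate two permutations that have no fixed point, no
cycle of length `≤ W`, and move more than `W` points, beyond their signs:
`g σ · sgn σ = g τ · sgn τ` (fermionic end: `c₁ = 0` and every `c_j`, `j ∈ m`, vanishes on both —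
`j ≤ m.sum ≤ W`; perturbative end: both values are `0`). [folklore] -/
theorem IsLocalGenerator.mul_sign_eq {n W : ℕ} {g : Equiv.Perm (Fin n) → ℂ}
    (hg : IsLocalGenerator n W g) {σ τ : Equiv.Perm (Fin n)}
    (hσ₁ : (Finset.univ.filter fun i => σ i = i).card = 0)
    (hτ₁ : (Finset.univ.filter fun i => τ i = i).card = 0)
    (hσc : ∀ j ≤ W, σ.cycleType.count j = 0) (hτc : ∀ j ≤ W, τ.cycleType.count j = 0)
    (hσs : W < σ.support.card) (hτs : W < τ.support.card) :
    g σ * ((Equiv.Perm.sign σ : ℤ) : ℂ) = g τ * ((Equiv.Perm.sign τ : ℤ) : ℂ) := by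
  rcases hg with ⟨F, m, -, hmsum, rfl⟩ | ⟨G, rfl⟩
  · have hP : (m.map fun j => ((σ.cycleType.count j : ℕ) : ℂ)).prod =
        (m.map fun j => ((τ.cycleType.count j : ℕ) : ℂ)).prod := by
      refine congrArg Multiset.prod (Multiset.map_congr rfl fun j hj => ?_)
      have hjW : j ≤ W := (Multiset.le_sum_of_mem hj).trans hmsum
      rw [hσc j hjW, hτc j hjW]
    dsimp only
    rw [hσ₁, hτ₁, hP, mul_comm _ (((Equiv.Perm.sign σ : ℤ) : ℂ)),
      mul_comm _ (((Equiv.Perm.sign τ : ℤ) : ℂ)), ← mul_assoc, ← mul_assoc, ← mul_assoc,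
      ← mul_assoc, TwistedDetRankTdrSuperadditive.sign_mul_sign_self,
      TwistedDetRankTdrSuperadditive.sign_mul_sign_self]
  · dsimp only
    rw [if_neg (not_le.mpr hσs), if_neg (not_le.mpr hτs), zero_mul, zero_mul]

/-- **The trivial class function is not quasi-local.**  For any `c`, take `n = 2^k` with
`8·(k + c)^c < 2^k` (`directSumToTdr_exists_pow_add_lt`), `W = (log₂ n + c)^c = (k + c)^c`, an
`n`-cycle `σ` and a permutation `τ` of type `(W + 2, n - W - 2)` (`Equiv.Perm.exists_with_cycleType_iff`);
by `IsLocalGenerator.mul_sign_eq` every combination `χ` of local generators of weight `W` has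
`χ σ · sgn σ = χ τ · sgn τ`, so `χ ≡ 1` would give `sgn σ = sgn τ = -sgn σ`. [folklore] -/
theorem one_not_isQuasiLocal :
    ¬ IsQuasiLocal (fun (n : ℕ) (_ : Equiv.Perm (Fin n)) => (1 : ℂ)) := by
  rintro ⟨c, hc⟩
  obtain ⟨k, hk⟩ := directSumToTdr_exists_pow_add_lt (1 / 8) (by norm_num) c c
  set W : ℕ := (k + c) ^ c with hW
  have hW1 : 1 ≤ W := by
    rcases Nat.eq_zero_or_pos c with rfl | hc0
    · simp [hW]
    · exact Nat.one_le_pow _ _ (by omega)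
  have hkW : 8 * W < 2 ^ k := by
    have h : ((8 * W : ℕ) : ℝ) < ((2 ^ k : ℕ) : ℝ) := by
      push_cast [hW] at hk ⊢
      linarith
    exact_mod_cast h
  set n : ℕ := 2 ^ k with hn
  have hn1 : 1 ≤ n := Nat.one_le_two_pow
  have hlog : Nat.log 2 n = k := by rw [hn, Nat.log_pow one_lt_two]
  obtain ⟨r, -, a, g, hg, h1⟩ := hc n hn1
  rw [hlog] at hg
  -- an `n`-cycle and a permutation of type `(W + 2, n - (W + 2))`
  obtain ⟨σ, hσ⟩ : ∃ σ : Equiv.Perm (Fin n), σ.cycleType = {n} :=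
    (Equiv.Perm.exists_with_cycleType_iff (α := Fin n)).2
      ⟨by simp, by simp only [Multiset.mem_singleton, forall_eq]; omega⟩
  obtain ⟨τ, hτ⟩ : ∃ τ : Equiv.Perm (Fin n), τ.cycleType = {W + 2, n - (W + 2)} :=
    (Equiv.Perm.exists_with_cycleType_iff (α := Fin n)).2
      ⟨by simp only [Multiset.insert_eq_cons, Multiset.sum_cons, Multiset.sum_singleton,
            Fintype.card_fin]; omega,
       by simp only [Multiset.insert_eq_cons, Multiset.mem_cons, Multiset.mem_singleton]
          rintro j (rfl | rfl) <;> omega⟩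
  have hσsum : σ.cycleType.sum = n := by rw [hσ]; simp
  have hτsum : τ.cycleType.sum = n := by
    rw [hτ]
    simp only [Multiset.insert_eq_cons, Multiset.sum_cons, Multiset.sum_singleton]
    omega
  -- no fixed points, long cycles only, full support
  have hsupp : ∀ ρ : Equiv.Perm (Fin n), ρ.cycleType.sum = n → ρ.support = Finset.univ := by
    intro ρ h
    apply Finset.eq_univ_of_card
    rw [← Equiv.Perm.sum_cycleType, h, Fintype.card_fin]
  have hfix : ∀ ρ : Equiv.Perm (Fin n), ρ.cycleType.sum = n →
      (Finset.univ.filter fun i => ρ i = i).card = 0 := by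
    intro ρ h
    rw [Finset.card_eq_zero, Finset.filter_eq_empty_iff]
    intro i _
    exact Equiv.Perm.mem_support.1 ((hsupp ρ h).symm ▸ Finset.mem_univ i)
  have hbig : ∀ ρ : Equiv.Perm (Fin n), ρ.cycleType.sum = n → W < ρ.support.card := by
    intro ρ h
    rw [hsupp ρ h, Finset.card_univ, Fintype.card_fin]
    omega
  have hσc : ∀ j ≤ W, σ.cycleType.count j = 0 := fun j hj =>
    Multiset.count_eq_zero.2 (by rw [hσ, Multiset.mem_singleton]; omega)
  have hτc : ∀ j ≤ W, τ.cycleType.count j = 0 := fun j hj =>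
    Multiset.count_eq_zero.2 (by
      rw [hτ]
      simp only [Multiset.insert_eq_cons, Multiset.mem_cons, Multiset.mem_singleton]
      omega)
  -- opposite signs
  have hsign : ((Equiv.Perm.sign τ : ℤ) : ℂ) = -((Equiv.Perm.sign σ : ℤ) : ℂ) := by
    have h : Equiv.Perm.sign τ = -Equiv.Perm.sign σ := by
      rw [Equiv.Perm.sign_of_cycleType, Equiv.Perm.sign_of_cycleType, hσ, hτ]
      simp only [Multiset.insert_eq_cons, Multiset.sum_cons, Multiset.sum_singleton,
        Multiset.card_cons, Multiset.card_singleton]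
      rw [show W + 2 + (n - (W + 2)) + (1 + 1) = (n + 1) + 1 by omega, pow_succ _ (n + 1),
        mul_neg_one]
    rw [h, Units.val_neg, Int.cast_neg]
  -- every generator, hence `χ ≡ 1`, satisfies `χ σ · sgn σ = χ τ · sgn τ`
  have key : ∀ t, g t σ * ((Equiv.Perm.sign σ : ℤ) : ℂ) = g t τ * ((Equiv.Perm.sign τ : ℤ) : ℂ) :=
    fun t => (hg t).mul_sign_eq (hfix σ hσsum) (hfix τ hτsum) hσc hτc (hbig σ hσsum) (hbig τ hτsum)
  have e1 : ∀ ρ : Equiv.Perm (Fin n), (1 : ℂ) = ∑ t, a t * g t ρ := fun ρ => by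
    simpa [Finset.sum_apply, smul_eq_mul] using congr_fun h1 ρ
  have heq : ((Equiv.Perm.sign σ : ℤ) : ℂ) = ((Equiv.Perm.sign τ : ℤ) : ℂ) :=
    calc ((Equiv.Perm.sign σ : ℤ) : ℂ) = (∑ t, a t * g t σ) * ((Equiv.Perm.sign σ : ℤ) : ℂ) := by
          rw [← e1 σ, one_mul]
      _ = ∑ t, a t * (g t σ * ((Equiv.Perm.sign σ : ℤ) : ℂ)) := by
          rw [Finset.sum_mul]
          exact Finset.sum_congr rfl fun t _ => mul_assoc _ _ _
      _ = ∑ t, a t * (g t τ * ((Equiv.Perm.sign τ : ℤ) : ℂ)) := by simp_rw [key]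
      _ = (∑ t, a t * g t τ) * ((Equiv.Perm.sign τ : ℤ) : ℂ) := by
          rw [Finset.sum_mul]
          exact Finset.sum_congr rfl fun t _ => (mul_assoc _ _ _).symm
      _ = ((Equiv.Perm.sign τ : ℤ) : ℂ) := by rw [← e1 τ, one_mul]
  rw [hsign] at heq
  have hne : ((Equiv.Perm.sign σ : ℤ) : ℂ) ≠ 0 := by
    rcases Int.units_eq_one_or (Equiv.Perm.sign σ) with h | h <;> simp [h]
  have h2 : (2 : ℂ) * ((Equiv.Perm.sign σ : ℤ) : ℂ) = 0 := by linear_combination heq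
  simp only [mul_eq_zero, OfNat.ofNat_ne_zero, false_or] at h2
  exact hne h2

/-- **CALIBRATION — stub A implies the summit.**  If every p-computable class-function GMF family had
quasi-local coefficients, then `VP ℂ ≠ VNP ℂ`: otherwise the permanent family is p-computable
(`isPComputable_perPoly_complex_iff`, Bürgisser 2000 Rem. 2.11/Thm. 2.10), `per_n` is the GMF of
the class function `χ ≡ 1`, and `χ ≡ 1` is not quasi-local (`one_not_isQuasiLocal`).  Hence the
registered stub `stub_cheapClassFunctionsAreQuasiLocal` of line `registered` is at least as hard
as `ValiantsHypothesis` itself. [folklore] -/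
theorem valiantsHypothesis_of_cheapClassFunctionsAreQuasiLocal :
    CheapClassFunctionsAreQuasiLocal → _root_.ValiantsHypothesis := by
  intro hA
  show VP ℂ ≠ VNP ℂ
  intro hEq
  have hper : IsPComputable (fun n => perPoly (Fin n) ℂ) :=
    isPComputable_perPoly_complex_iff.2 hEq
  have hfun : (fun n => ∑ σ : Equiv.Perm (Fin n), MvPolynomial.C (1 : ℂ) *
        ∏ i : Fin n, (MvPolynomial.X (σ i, i) : MvPolynomial (Fin n × Fin n) ℂ)) =
      (fun n => perPoly (Fin n) ℂ) := by
    funext n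
    simp [perPoly, Matrix.permanent]
  have hcomp : IsPComputable (fun n => ∑ σ : Equiv.Perm (Fin n), MvPolynomial.C (1 : ℂ) *
        ∏ i : Fin n, (MvPolynomial.X (σ i, i) : MvPolynomial (Fin n × Fin n) ℂ)) := by
    rw [hfun]; exact hper
  exact one_not_isQuasiLocal (hA (fun _ _ => (1 : ℂ)) (fun _ _ _ => rfl) hcomp)

end Summit.ValiantsHypothesis.ValiantsHypothesis.Theorems.TwistedDetRankFermionicNormalForm

end
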